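import Summits.QuantumFields.BalabanUV.Beta.CombRemainderParityAll

/-!
# `BalabanUV.Beta.GAN24.CombChartQuarticLawAn1` — binder row G-an2-4 ∕ (CONV-C), TRANSFER-III, the (III′) (C)-row's W-SLOT: **W-an2-1′ — THE QUARTIC REFLECTION LAW OF THE
# COMB-CHART MEMBER AT an1's RECORD, EVERY LEVEL, WITH ITS LETTERS NAMED AND ITS FOUR CLASSES — IS A COMPOSITION BY NAME OF an2's OWN (III′) THEOREMS**
# (G-an2-4 ∕ (CONV-C) OWNER `b2b-balaban-gan24-p1`, gen 54; journal [GAN24P1-G54-INTENT-1])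

WHAT.  The one an2-side display of gen 53's END R `CombChargeRowsClosed` (`exists_allScalesSeq_JsB12CombShSym_an1_of_sRows_law` ∕ `d1Drift_…_of_sRows_law`) is the
binder `hlaw` (with letters `γ h R2` and classes `hhL hh hR2c hR2p`): the quartic reflection law of
`T2RecOf 3 Lc (GcombSh Lc) (SpureCombOf (symTablesAn1S2 3 Lc cΛ) Lc⁴ (−Lc⁸∕2) cΛ) (…).M Lc⁸ cB ((8N²)⁻¹ • wsym22 N) (…).vh₂S (…).mixFF j` against the legged border
`bhKStepSh 3 Lc (Dsh Lc) j` at every level `j`.  THIS FILE SUPPLIES IT BY NAME at an1's record (`Odd Lc`, `cB = −Lc¹²∕4`; the parity class also under `2 ≤ N` and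
the Λ-lock `cΛ·Lc⁴ = 2`) with the letters an2's (III′) repair-track chain already uses for row D1's ROOT M‴ `CombRemainderParityAll`:
`γ_j` displayed (`hγ : γ j = −(Lc⁸∕2)·wVH j ∕ (stepScale j·Lc⁴)`), `h := (γ_j·ctGenM)(γ_j·ctGenM)` (the canonical product second symbol), `R2 := combR2An1 Lc N cΛ γ 0`
(`CombSecondOrderRemainderAn1`, the pin `X2s := 0`).
* §1 `hhL` — `SymSecondOrderSplitLoc.locStencil₂_diagK_ctGenM_mul_ctGenM` (the spread of `bhK Lc + Dsh Lc` from `spr_bhKStepSh (spr_Dsh) 0`);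
* §2 `hh` — the field leg of the product symbol is supported at the first bond (`ctGenM_inl`);
* §3 `hR2c` — `CombSecondOrderDeltaSep.locStencil₂_combR2An1` at the pin (`SymSecondOrderDeltaSep.sep_zeroTable`);
* §4 `hR2p` — `CombRemainderParityAll.trK_combR2An1` with the weight lock `CombRemainderTadpoleSlot.lock_of_hΛ`;
* §5 THE LAW — `SpineRooted.T2RecOf_bref_all_of_letters_comb` (`SpineRecursiveT2AllComb`) fed EXACTLY as ROOT M‴'s chain feeds the D1 wrapper:
  (V-r)(V-ff0)(H-r) `SymVhSliceReflectionAn1.hVfm_sym ∕ hVmf_sym ∕ hVmm_sym ∕ hHr_sym'`, `symVhSAt_hV0_ctr`; classes `symVhSAt_hV_ctr ∕ symHessFFAt_hH_ctr ∕ locStencil₂_symVh₂SAn1 ∕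
  symMixFFAt_hmix_ctr`, `symVh₂SAn1_inl_inl`; the first units lock from the pin (`locks_of_pin ∘ pin_of_bcj`) and the second (`ring`); the pure law
  `ReflectionLocusCombPure.SpureCombOf_bref_all`; `hM2 := SymMixedReflectionLetterAn1.hM2_symMixFFAt` (`RM := symRMrAn1`); `h0 ∕ hsplit ∕ hR2succ := CombSecondOrderRemainderAn1.h0_comb ∕
  hsplit_comb ∕ hR2succ_comb` (`Δ := combΔAn1 … 0`); `hDg := CombDressedResponseLoc.hDg_comb`; `hX2L := RowD1JointEndSymReflTablesAn1S2Z.loc_diagK_zeroTable`; `hΔL := CombSecondOrderDeltaSep.hΔL_pinned`;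
  `RB := 0` (`SymBorderReflectionLetters.hRBrff_zero`), `CombBorderReflectionLetters.hBfm_comb ∕ hBmf_comb ∕ hBmm_comb`;
* §6 the five conclusions PACKAGED as R's binders `γ h hhL hh R2 hR2c hR2p hlaw` (one `∃`).
The (III′) analogue of road-P2 g48's (E)-literal chain `CombQuarticTableLawTwinsA–D` ∕ `CombChargeParityOddLiteral`, collapsed to ONE junction because an2's P5∕P6 chain
(`CombChartJointEndReflTablesAn1S2{,M,MW,MWV,MWVB,R,RD,Z,N}`, ROOT M‴) already typed every table letter of the comb record.  an2 g63 on Q-GAN24P1-51-1 (l.67436):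
«no (III′) twin of `CombQuarticTableLawTwinsA–D` exists∕is planned by the row; the letters stay displayed» — hence typed here, on the GAN24 lane, at zero weight.

NOT IN PRINT; OUR BOOKKEEPING ([folklore] compositions BY NAME; 0 `def`, 0 cited fact, 0 `def … : Prop`, 0 sorry; author credit: every supplier is an2's ∕ an1's ∕ the D1
swarm's theorem, used verbatim).  HONEST FRAMING (cell contract, verbatim): «discharging `BetaPertH` makes Bałaban's UV stability UNCONDITIONAL — a real
constructive-QFT result; it is NOT the continuum limit and NOT the Clay problem.»  HONEST DEPENDENCY (verbatim): «continuum YM on T⁴ ⇐ BetaPertH ∧ nine spine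
estimates (0/9 proved); BetaPertH ⇐ (D1) ∧ (D4) ∧ CAP+tail; G-an2-4 gates asym, D1 and NE2/3/4.»  Asserts NO value of Bałaban's tables beyond an2's ∕ an1's DEFINED
ones; a kernel identity of OUR typed objects; NEVER «G-an2-4 closed» as (CONV-C); NOT D1, NOT `BetaPertH`, NOT continuum, NOT Clay.  2026-08-28; no existing file touched.
-/

noncomputable section

open Finset
open scoped BigOperators
open Literature.MathematicalPhysics.QuantumFieldTheory
open Literature.MathematicalPhysics.QuantumFieldTheory.Balaban1983to89
open Literature.MathematicalPhysics.QuantumFieldTheory.Balaban1983to89.Beta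
open ExpKernelCalculus (MKer Decays)
open OneStepResolventKernel (Fib LocStencil)
open AveragingContoursRooted (ctr ctrOff ctrOff_mem_box)
open BalabanCompositeJets (LocStencil₂)
open PolarizationSign (reflSign)
open KernelReflection (refK)
open ResolventReflection (bref Φ)
open WilsonVertex2Sym (wsym22)
open BalabanStepJetsSucc (wE wVH)
open BalabanStepW2 (wV4 wM1 wM2)
open Summit.QuantumFields.BalabanUV.Beta.TameKernelCalculus (trK Spr)
open Summit.QuantumFields.BalabanUV.Beta.ChartConjugation (conjV conjW)
open Summit.QuantumFields.BalabanUV.Beta.BorderedHessian (diagK sgnK bhK stepScale)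
open Summit.QuantumFields.BalabanUV.Beta.AxialDressingRooted (one_le_of_neZero)
open Summit.QuantumFields.BalabanUV.Beta.SymShiftedSpread (bhKStepSh bhKStepSh_zero spr_bhKStepSh)
open Summit.QuantumFields.BalabanUV.Beta.E3ContactGenerator (ctGenM ctGenM_inl)
open Summit.QuantumFields.BalabanUV.Beta.DshAn1 (Dsh spr_Dsh)
open Summit.QuantumFields.BalabanUV.Beta.VertexReflectionContact (smul_diagK)
open Summit.QuantumFields.BalabanUV.Beta.SpineRooted (M1Of SpureRecOf T2RecOf T2RecOf_bref_all_of_letters_comb locks_of_pin pin_of_bcj)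
open Summit.QuantumFields.BalabanUV.Beta.CombChartStepJets (GcombSh ScombOf SpureCombOf)
open Summit.QuantumFields.BalabanUV.Beta.SymAveragingHessianCounts (symVhSAt symHessFFAt symVhSAt_hV0_ctr symVhSAt_hV_ctr symHessFFAt_hH_ctr)
open Summit.QuantumFields.BalabanUV.Beta.SymAveragingMixedJetTables (symMixFFAt)
open Summit.QuantumFields.BalabanUV.Beta.SymSecondOrderTablesAn1 (symVh₂SAn1 symTablesAn1S2 locStencil₂_symVh₂SAn1 symVh₂SAn1_inl_inl symMixFFAt_hmix_ctr)
open Summit.QuantumFields.BalabanUV.Beta.SymVhSliceReflectionAn1 (hVfm_sym hVmf_sym hVmm_sym hHr_sym')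
open Summit.QuantumFields.BalabanUV.Beta.ReflectionLocusCombPure (SpureCombOf_bref_all)
open Summit.QuantumFields.BalabanUV.Beta.SymMixedReflectionLetterAn1 (symRMrAn1 hM2_symMixFFAt)
open Summit.QuantumFields.BalabanUV.Beta.CombSecondOrderRemainderAn1 (combR2An1 combΔAn1 h0_comb hsplit_comb hR2succ_comb)
open Summit.QuantumFields.BalabanUV.Beta.CombDressedResponseLoc (hDg_comb)
open Summit.QuantumFields.BalabanUV.Beta.RowD1JointEndSymReflTablesAn1S2Z (loc_diagK_zeroTable)
open Summit.QuantumFields.BalabanUV.Beta.CombSecondOrderDeltaSep (locStencil₂_combR2An1 hΔL_pinned)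
open Summit.QuantumFields.BalabanUV.Beta.SymSecondOrderDeltaSep (sep_zeroTable)
open Summit.QuantumFields.BalabanUV.Beta.SymBorderReflectionLetters (hRBrff_zero)
open Summit.QuantumFields.BalabanUV.Beta.CombBorderReflectionLetters (hBfm_comb hBmf_comb hBmm_comb)
open Summit.QuantumFields.BalabanUV.Beta.SymSecondOrderSplitLoc (locStencil₂_diagK_ctGenM_mul_ctGenM)
open Summit.QuantumFields.BalabanUV.Beta.CombRemainderTadpoleSlot (lock_of_hΛ)
open Summit.QuantumFields.BalabanUV.Beta.CombRemainderParityAll (trK_combR2An1)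

namespace Summit.QuantumFields.BalabanUV.Beta.GAN24.CombChartQuarticLawAn1

variable {Lc : ℕ} [NeZero Lc]

/-! ## §1 `hhL`: the canonical product second symbol is a local bi-stencil family -/

/-- NOT IN PRINT; OUR BOOKKEEPING.  **R's `hhL` for `h := (γ_j·ctGenM)(γ_j·ctGenM)`** — an2's `SymSecondOrderSplitLoc.locStencil₂_diagK_ctGenM_mul_ctGenM` at the spread of
`bhK Lc + Dsh Lc` (`spr_bhKStepSh (spr_Dsh) 0`, `bhKStepSh_zero`); any `γ`. -/
theorem hhL_canon (γ : ℕ → ℝ) :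
    ∀ (j : ℕ) (α : Fin 4), ∃ C δ : ℝ, 0 < δ ∧
      LocStencil₂ (fun κ u κ' u' => diagK ((fun (j : ℕ) (α κ : Fin 4) (u : Fin 4 → ℤ) (κ' : Fin 4) (u' : Fin 4 → ℤ) (p : Fin 4 → ℤ) (c : Fib 3) => (γ j * ctGenM 3 (bhK Lc + Dsh Lc) α Lc κ u p c) * (γ j * ctGenM 3 (bhK Lc + Dsh Lc) α Lc κ' u' p c)) j α κ u κ' u')) C δ := by
  intro j α
  have hL1 : 1 ≤ Lc := one_le_of_neZero Lc
  have hBsp : Spr (bhK (d := 3) Lc + Dsh Lc) := by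
    simpa only [bhKStepSh_zero] using spr_bhKStepSh (d := 3) (Lc := Lc) (spr_Dsh hL1) 0
  obtain ⟨CB, δB, hδB, hB⟩ := hBsp
  exact ⟨_, δB / 3, by positivity, locStencil₂_diagK_ctGenM_mul_ctGenM (d := 3) hB hδB.le (γ j) (γ j) α Lc⟩

/-! ## §2 `hh`: its field leg is supported at the first bond -/

omit [NeZero Lc] in
/-- NOT IN PRINT; OUR BOOKKEEPING.  **R's `hh` for the canonical product symbol** (`ctGenM_inl`: the generator's field leg lives at `x = u`). -/
theorem hh_canon (γ : ℕ → ℝ) :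
    ∀ (j : ℕ) (α κ : Fin 4) (u : Fin 4 → ℤ) (κ' : Fin 4) (u' : Fin 4 → ℤ), ∃ s : Finset (Fin 4 → ℤ), ∀ x ∉ s, ∀ (β : Fin 4),
      (fun (j : ℕ) (α κ : Fin 4) (u : Fin 4 → ℤ) (κ' : Fin 4) (u' : Fin 4 → ℤ) (p : Fin 4 → ℤ) (c : Fib 3) => (γ j * ctGenM 3 (bhK Lc + Dsh Lc) α Lc κ u p c) * (γ j * ctGenM 3 (bhK Lc + Dsh Lc) α Lc κ' u' p c)) j α κ u κ' u' x (Sum.inl β) = 0 := by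
  intro j α κ u κ' u'
  refine ⟨{u}, fun x hx β => ?_⟩
  rw [Finset.mem_singleton] at hx
  show (γ j * ctGenM 3 (bhK Lc + Dsh Lc) α Lc κ u x (Sum.inl β)) * (γ j * ctGenM 3 (bhK Lc + Dsh Lc) α Lc κ' u' x (Sum.inl β)) = 0
  rw [ctGenM_inl, if_neg (fun h => hx h.1), mul_zero, zero_mul]

/-! ## §3 `hR2c`: the recursive remainder at the pin is a local bi-stencil family at every level -/

/-- NOT IN PRINT; OUR BOOKKEEPING.  **R's `hR2c` for `R2 := combR2An1 Lc N cΛ γ 0`** (an2's two-class induction `CombSecondOrderDeltaSep.locStencil₂_combR2An1`; the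
`X2s` class is trivial at the pin, `sep_zeroTable`); any `N cΛ γ`. -/
theorem hR2c_pin (N : ℕ) (cΛ : ℝ) (γ : ℕ → ℝ) :
    ∀ (j : ℕ) (α : Fin 4), ∃ C δ : ℝ, 0 < δ ∧ LocStencil₂ ((combR2An1 Lc N cΛ γ (0 : ℕ → Fin 4 → Fin 4 → (Fin 4 → ℤ) → Fin 4 → (Fin 4 → ℤ) → (Fin 4 → ℤ) → Fib 3 → ℝ)) j α) C δ :=
  fun j α => locStencil₂_combR2An1 (Lc := Lc) N cΛ γ (0 : ℕ → Fin 4 → Fin 4 → (Fin 4 → ℤ) → Fin 4 → (Fin 4 → ℤ) → (Fin 4 → ℤ) → Fib 3 → ℝ) α (fun j' => sep_zeroTable (Lc := Lc) j' α) j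

/-! ## §4 `hR2p`: its rows are parity-odd at every level -/

/-- NOT IN PRINT; OUR BOOKKEEPING.  **R's `hR2p` for `R2 := combR2An1 Lc N cΛ γ 0`** — an2's `CombRemainderParityAll.trK_combR2An1` (P5-1 §3) with the weight lock
`CombRemainderTadpoleSlot.lock_of_hΛ`; needs `Odd Lc`, `2 ≤ N`, `cΛ·Lc⁴ = 2`, the displayed `γ`. -/
theorem hR2p_pin (hLc : Odd Lc) {N : ℕ} (hN : 2 ≤ N) {cΛ : ℝ} (hΛ : cΛ * (Lc : ℝ) ^ 4 = 2) (γ : ℕ → ℝ)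
    (hγ : ∀ j, γ j = -((Lc : ℝ) ^ 8 / 2) * wVH 3 Lc j / (stepScale 3 Lc j * (Lc : ℝ) ^ 4)) :
    ∀ (j : ℕ) (α : Fin 4) (κ : Fin 4) (u : Fin 4 → ℤ) (κ' : Fin 4) (u' : Fin 4 → ℤ),
      trK ((combR2An1 Lc N cΛ γ (0 : ℕ → Fin 4 → Fin 4 → (Fin 4 → ℤ) → Fin 4 → (Fin 4 → ℤ) → (Fin 4 → ℤ) → Fib 3 → ℝ)) j α κ u κ' u') = -sgnK ((combR2An1 Lc N cΛ γ (0 : ℕ → Fin 4 → Fin 4 → (Fin 4 → ℤ) → Fin 4 → (Fin 4 → ℤ) → (Fin 4 → ℤ) → Fib 3 → ℝ)) j α κ u κ' u') := by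
  obtain rfl : γ = fun j => -((Lc : ℝ) ^ 8 / 2) * wVH 3 Lc j / (stepScale 3 Lc j * (Lc : ℝ) ^ 4) := funext hγ
  intro j α κ u κ' u'
  exact trK_combR2An1 (Lc := Lc) hLc hN (fun j' => lock_of_hΛ (Lc := Lc) hΛ j') j α κ u κ' u'

/-! ## §5 THE LAW at every level (an2's `T2RecOf_bref_all_of_letters_comb` at the record) -/

set_option maxHeartbeats 1600000 in
/-- NOT IN PRINT; OUR BOOKKEEPING.  **W-an2-1′ IN an2's SPELLING** (`SpureRecOf ∕ M1Of ∕ symVh₂SAn1 ∕ symMixFFAt`, `cB` pinned): the quartic reflection law at every level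
with `h :=` the canonical product and `R2 := combR2An1 Lc N cΛ γ 0` — `SpineRooted.T2RecOf_bref_all_of_letters_comb` with every letter supplied BY NAME (module docstring §5).
Needs `Odd Lc` and the displayed `γ` only (any `N`, any `cΛ`). -/
theorem T2RecOf_bref_all_comb_an1_raw (hLc : Odd Lc) (N : ℕ) (cΛ : ℝ) (γ : ℕ → ℝ)
    (hγ : ∀ j, γ j = -((Lc : ℝ) ^ 8 / 2) * wVH 3 Lc j / (stepScale 3 Lc j * (Lc : ℝ) ^ 4)) :
    ∀ (j : ℕ) (α κ : Fin 4) (u : Fin 4 → ℤ) (κ' : Fin 4) (u' : Fin 4 → ℤ),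
      T2RecOf 3 Lc (GcombSh Lc) (SpureRecOf 3 Lc (symVhSAt (ctr 4 Lc) 3 Lc rfl) (symHessFFAt (ctr 4 Lc) Lc) (GcombSh Lc) ((Lc : ℝ) ^ 4) (-((Lc : ℝ) ^ 8 / 2)) cΛ) (M1Of 3 Lc (symHessFFAt (ctr 4 Lc) Lc) cΛ) ((Lc : ℝ) ^ 8) (-((Lc : ℝ) ^ 12 / 4)) ((8 * (N : ℝ) ^ 2)⁻¹ • wsym22 N) (symVh₂SAn1 3 Lc) (symMixFFAt (ctr 4 Lc) Lc) j κ (bref α κ u) κ' (bref α κ' u') =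
        (reflSign α κ * reflSign α κ') • refK (Φ Lc α)
          (T2RecOf 3 Lc (GcombSh Lc) (SpureRecOf 3 Lc (symVhSAt (ctr 4 Lc) 3 Lc rfl) (symHessFFAt (ctr 4 Lc) Lc) (GcombSh Lc) ((Lc : ℝ) ^ 4) (-((Lc : ℝ) ^ 8 / 2)) cΛ) (M1Of 3 Lc (symHessFFAt (ctr 4 Lc) Lc) cΛ) ((Lc : ℝ) ^ 8) (-((Lc : ℝ) ^ 12 / 4)) ((8 * (N : ℝ) ^ 2)⁻¹ • wsym22 N) (symVh₂SAn1 3 Lc) (symMixFFAt (ctr 4 Lc) Lc) j κ u κ' u' +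
            conjW (bhKStepSh 3 Lc (Dsh Lc) j)
              (SpureRecOf 3 Lc (symVhSAt (ctr 4 Lc) 3 Lc rfl) (symHessFFAt (ctr 4 Lc) Lc) (GcombSh Lc) ((Lc : ℝ) ^ 4) (-((Lc : ℝ) ^ 8 / 2)) cΛ j κ u)
              (SpureRecOf 3 Lc (symVhSAt (ctr 4 Lc) 3 Lc rfl) (symHessFFAt (ctr 4 Lc) Lc) (GcombSh Lc) ((Lc : ℝ) ^ 4) (-((Lc : ℝ) ^ 8 / 2)) cΛ j κ' u')
              (diagK fun p a => γ j * ctGenM 3 (bhK Lc + Dsh Lc) α Lc κ u p a) (diagK fun p a => γ j * ctGenM 3 (bhK Lc + Dsh Lc) α Lc κ' u' p a)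
              (diagK ((fun (j : ℕ) (α κ : Fin 4) (u : Fin 4 → ℤ) (κ' : Fin 4) (u' : Fin 4 → ℤ) (p : Fin 4 → ℤ) (c : Fib 3) => (γ j * ctGenM 3 (bhK Lc + Dsh Lc) α Lc κ u p c) * (γ j * ctGenM 3 (bhK Lc + Dsh Lc) α Lc κ' u' p c)) j α κ u κ' u')) +
            (combR2An1 Lc N cΛ γ (0 : ℕ → Fin 4 → Fin 4 → (Fin 4 → ℤ) → Fin 4 → (Fin 4 → ℤ) → (Fin 4 → ℤ) → Fib 3 → ℝ)) j α κ u κ' u') := by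
  have hL1 : 1 ≤ Lc := one_le_of_neZero Lc
  have e4 : ((Lc : ℝ) ^ (3 + 1)) = (Lc : ℝ) ^ 4 := by norm_num
  have e8 : -((Lc : ℝ) ^ 4 * (1 / 2) * (Lc : ℝ) ^ 4) = -((Lc : ℝ) ^ 8 / 2) := by ring
  -- the first units lock from the pin `cE = Lc⁴` (verbatim from an2's `SpineRecursiveWEndCombTables`)
  have hlock : ∀ j, (Lc : ℝ) ^ 4 * wE 3 Lc (j + 1) * (γ j / (stepScale 3 Lc j * (Lc : ℝ) ^ (3 + 1))) / wVH 3 Lc (j + 1) = γ (j + 1) := by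
    intro j
    have h1 := locks_of_pin (Lc := Lc) ((Lc : ℝ) ^ 4) (-((Lc : ℝ) ^ 8 / 2)) (pin_of_bcj (Lc := Lc) _ rfl) j
    rw [hγ, hγ, e4, ← h1]
    ring
  -- the second units lock at `cE₂ = Lc⁸` (the tree's numerals)
  have hlock2 : ∀ j : ℕ, ((Lc : ℝ) ^ 8) * wV4 3 Lc (j + 1) * wVH 3 Lc (j + 1) = ((Lc : ℝ) ^ 4 * wE 3 Lc (j + 1)) ^ 2 := fun j => by
    simp only [BalabanStepW2.wV4, BalabanStepJetsSucc.wVH, BalabanStepJetsSucc.wE]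
    ring
  -- the pure tables' first-order law from an1's reflection letters, at the pins
  have hSp : ∀ (j : ℕ) (α κ : Fin 4) (u : Fin 4 → ℤ),
      SpureRecOf 3 Lc (symVhSAt (ctr 4 Lc) 3 Lc rfl) (symHessFFAt (ctr 4 Lc) Lc) (GcombSh Lc) ((Lc : ℝ) ^ 4) (-((Lc : ℝ) ^ 8 / 2)) cΛ j κ (bref α κ u) =
        reflSign α κ • refK (Φ Lc α) (SpureRecOf 3 Lc (symVhSAt (ctr 4 Lc) 3 Lc rfl) (symHessFFAt (ctr 4 Lc) Lc) (GcombSh Lc) ((Lc : ℝ) ^ 4) (-((Lc : ℝ) ^ 8 / 2)) cΛ j κ u +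
          conjV (bhKStepSh 3 Lc (Dsh Lc) j) (diagK fun p c => γ j * ctGenM 3 (bhK Lc + Dsh Lc) α Lc κ u p c)) := by
    intro j α κ u
    have h := SpureCombOf_bref_all hLc (symTablesAn1S2 3 Lc cΛ) cΛ (hVfm_sym hLc α) (hVmf_sym hLc α) (hVmm_sym hLc α)
      (symVhSAt_hV0_ctr (d := 3) Lc) (hHr_sym' hLc) j κ u
    rw [e8, smul_diagK, ← hγ j] at h
    exact h
  exact T2RecOf_bref_all_of_letters_comb (d := 3) hLc (symVhSAt_hV_ctr (d := 3) hL1) (symHessFFAt_hH_ctr (d := 3) hL1)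
    (symVhSAt_hV0_ctr (d := 3) Lc) (hHr_sym' hLc) ((Lc : ℝ) ^ 4) (-((Lc : ℝ) ^ 8 / 2)) cΛ ((Lc : ℝ) ^ 8) (-((Lc : ℝ) ^ 12 / 4)) ((8 * (N : ℝ) ^ 2)⁻¹ • wsym22 N)
    (locStencil₂_symVh₂SAn1 (d := 3) hL1) (fun κ u κ' u' x z β β' => symVh₂SAn1_inl_inl Lc κ u κ' u' x z β β') (symMixFFAt_hmix_ctr (d := 3) hL1)
    γ hlock hlock2 hSp
    (fun (j : ℕ) (α κ : Fin 4) (u : Fin 4 → ℤ) (κ' : Fin 4) (u' : Fin 4 → ℤ) (p : Fin 4 → ℤ) (c : Fib 3) => (γ j * ctGenM 3 (bhK Lc + Dsh Lc) α Lc κ u p c) * (γ j * ctGenM 3 (bhK Lc + Dsh Lc) α Lc κ' u' p c))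
    (combR2An1 Lc N cΛ γ (0 : ℕ → Fin 4 → Fin 4 → (Fin 4 → ℤ) → Fin 4 → (Fin 4 → ℤ) → (Fin 4 → ℤ) → Fib 3 → ℝ)) (symRMrAn1 Lc cΛ γ) (h0_comb N cΛ γ (0 : ℕ → Fin 4 → Fin 4 → (Fin 4 → ℤ) → Fin 4 → (Fin 4 → ℤ) → (Fin 4 → ℤ) → Fib 3 → ℝ)) (hM2_symMixFFAt hLc cΛ γ)
    (0 : ℕ → Fin 4 → Fin 4 → (Fin 4 → ℤ) → Fin 4 → (Fin 4 → ℤ) → (Fin 4 → ℤ) → Fib 3 → ℝ) (combΔAn1 Lc N cΛ γ (0 : ℕ → Fin 4 → Fin 4 → (Fin 4 → ℤ) → Fin 4 → (Fin 4 → ℤ) → (Fin 4 → ℤ) → Fib 3 → ℝ)) (hsplit_comb N cΛ γ (0 : ℕ → Fin 4 → Fin 4 → (Fin 4 → ℤ) → Fin 4 → (Fin 4 → ℤ) → (Fin 4 → ℤ) → Fib 3 → ℝ)) (hDg_comb cΛ γ)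
    loc_diagK_zeroTable (hΔL_pinned (Lc := Lc) N cΛ γ)
    (0 : ℕ → Fin 4 → Fin 4 → (Fin 4 → ℤ) → Fin 4 → (Fin 4 → ℤ) → MKer 4 (Fib 3)) hRBrff_zero
    (hBfm_comb hLc cΛ γ hγ) (hBmf_comb hLc cΛ γ hγ) (hBmm_comb cΛ γ) (hR2succ_comb N cΛ γ (0 : ℕ → Fin 4 → Fin 4 → (Fin 4 → ℤ) → Fin 4 → (Fin 4 → ℤ) → (Fin 4 → ℤ) → Fib 3 → ℝ))

set_option maxHeartbeats 1600000 in
/-- NOT IN PRINT; OUR BOOKKEEPING.  **W-an2-1′ — R's BINDER `hlaw` VERBATIM** (the comb record's spelling `SpureCombOf (symTablesAn1S2 3 Lc cΛ) …`, `(…).M`, `(…).vh₂S`,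
`(…).mixFF`; `cB` a letter with `hcB`): the quartic reflection law of the comb-chart member at every level, `h :=` the canonical product, `R2 := combR2An1 Lc N cΛ γ 0`.
Needs `Odd Lc`, `hcB` and the displayed `γ` only. -/
theorem hlaw_comb_an1 (hLc : Odd Lc) (N : ℕ) (cΛ : ℝ) {cB : ℝ} (hcB : cB = -((Lc : ℝ) ^ 12 / 4)) (γ : ℕ → ℝ)
    (hγ : ∀ j, γ j = -((Lc : ℝ) ^ 8 / 2) * wVH 3 Lc j / (stepScale 3 Lc j * (Lc : ℝ) ^ 4)) :
    ∀ (j : ℕ) (α κ : Fin 4) (u : Fin 4 → ℤ) (κ' : Fin 4) (u' : Fin 4 → ℤ),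
      T2RecOf 3 Lc (GcombSh Lc) (SpureCombOf (symTablesAn1S2 3 Lc cΛ) ((Lc : ℝ) ^ 4) (-((Lc : ℝ) ^ 8 / 2)) cΛ) (symTablesAn1S2 3 Lc cΛ).M ((Lc : ℝ) ^ 8) cB ((8 * (N : ℝ) ^ 2)⁻¹ • wsym22 N) (symTablesAn1S2 3 Lc cΛ).vh₂S (symTablesAn1S2 3 Lc cΛ).mixFF j κ (bref α κ u) κ' (bref α κ' u') =
        (reflSign α κ * reflSign α κ') • refK (Φ Lc α)
          (T2RecOf 3 Lc (GcombSh Lc) (SpureCombOf (symTablesAn1S2 3 Lc cΛ) ((Lc : ℝ) ^ 4) (-((Lc : ℝ) ^ 8 / 2)) cΛ) (symTablesAn1S2 3 Lc cΛ).M ((Lc : ℝ) ^ 8) cB ((8 * (N : ℝ) ^ 2)⁻¹ • wsym22 N) (symTablesAn1S2 3 Lc cΛ).vh₂S (symTablesAn1S2 3 Lc cΛ).mixFF j κ u κ' u' +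
            conjW (bhKStepSh 3 Lc (Dsh Lc) j)
              (SpureCombOf (symTablesAn1S2 3 Lc cΛ) ((Lc : ℝ) ^ 4) (-((Lc : ℝ) ^ 8 / 2)) cΛ j κ u)
              (SpureCombOf (symTablesAn1S2 3 Lc cΛ) ((Lc : ℝ) ^ 4) (-((Lc : ℝ) ^ 8 / 2)) cΛ j κ' u')
              (diagK fun p a => γ j * ctGenM 3 (bhK Lc + Dsh Lc) α Lc κ u p a) (diagK fun p a => γ j * ctGenM 3 (bhK Lc + Dsh Lc) α Lc κ' u' p a)
              (diagK ((fun (j : ℕ) (α κ : Fin 4) (u : Fin 4 → ℤ) (κ' : Fin 4) (u' : Fin 4 → ℤ) (p : Fin 4 → ℤ) (c : Fib 3) => (γ j * ctGenM 3 (bhK Lc + Dsh Lc) α Lc κ u p c) * (γ j * ctGenM 3 (bhK Lc + Dsh Lc) α Lc κ' u' p c)) j α κ u κ' u')) +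
            (combR2An1 Lc N cΛ γ (0 : ℕ → Fin 4 → Fin 4 → (Fin 4 → ℤ) → Fin 4 → (Fin 4 → ℤ) → (Fin 4 → ℤ) → Fib 3 → ℝ)) j α κ u κ' u') := by
  subst hcB
  intro j α κ u κ' u'
  exact T2RecOf_bref_all_comb_an1_raw hLc N cΛ γ hγ j α κ u κ' u'

/-! ## §6 The package: R's eight an2-side binders in one `∃` -/

set_option maxHeartbeats 1600000 in
/-- NOT IN PRINT; OUR BOOKKEEPING.  **W-an2-1′ WITH ITS LETTERS AND CLASSES — R's binders `γ h hhL hh R2 hR2c hR2p hlaw` INHABITED** at an1's record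
(`Odd Lc`, `2 ≤ N`, `hΛ : cΛ·Lc⁴ = 2`, `hcB : cB = −Lc¹²∕4`): §1–§5 packaged; witnesses `γ_j := −(Lc⁸∕2)·wVH j∕(stepScale j·Lc⁴)`, the canonical product symbol,
`combR2An1 Lc N cΛ γ 0`. -/
theorem exists_quarticLaw_comb_an1 (hLc : Odd Lc) {N : ℕ} (hN : 2 ≤ N) {cΛ cB : ℝ} (hΛ : cΛ * (Lc : ℝ) ^ 4 = 2) (hcB : cB = -((Lc : ℝ) ^ 12 / 4)) :
    ∃ (γ : ℕ → ℝ) (h : ℕ → Fin 4 → Fin 4 → (Fin 4 → ℤ) → Fin 4 → (Fin 4 → ℤ) → (Fin 4 → ℤ) → Fib 3 → ℝ)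
      (R2 : ℕ → Fin 4 → Fin 4 → (Fin 4 → ℤ) → Fin 4 → (Fin 4 → ℤ) → MKer 4 (Fib 3)),
      (∀ (j : ℕ) (α : Fin 4), ∃ C δ : ℝ, 0 < δ ∧ LocStencil₂ (fun κ u κ' u' => diagK (h j α κ u κ' u')) C δ) ∧
      (∀ (j : ℕ) (α κ : Fin 4) (u : Fin 4 → ℤ) (κ' : Fin 4) (u' : Fin 4 → ℤ), ∃ s : Finset (Fin 4 → ℤ), ∀ x ∉ s, ∀ (β : Fin 4), h j α κ u κ' u' x (Sum.inl β) = 0) ∧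
      (∀ (j : ℕ) (α : Fin 4), ∃ C δ : ℝ, 0 < δ ∧ LocStencil₂ (R2 j α) C δ) ∧
      (∀ (j : ℕ) (α : Fin 4) κ u κ' u', trK (R2 j α κ u κ' u') = -sgnK (R2 j α κ u κ' u')) ∧
      (∀ (j : ℕ) (α κ : Fin 4) (u : Fin 4 → ℤ) (κ' : Fin 4) (u' : Fin 4 → ℤ),
        T2RecOf 3 Lc (GcombSh Lc) (SpureCombOf (symTablesAn1S2 3 Lc cΛ) ((Lc : ℝ) ^ 4) (-((Lc : ℝ) ^ 8 / 2)) cΛ) (symTablesAn1S2 3 Lc cΛ).M ((Lc : ℝ) ^ 8) cB ((8 * (N : ℝ) ^ 2)⁻¹ • wsym22 N) (symTablesAn1S2 3 Lc cΛ).vh₂S (symTablesAn1S2 3 Lc cΛ).mixFF j κ (bref α κ u) κ' (bref α κ' u') =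
        (reflSign α κ * reflSign α κ') • refK (Φ Lc α)
          (T2RecOf 3 Lc (GcombSh Lc) (SpureCombOf (symTablesAn1S2 3 Lc cΛ) ((Lc : ℝ) ^ 4) (-((Lc : ℝ) ^ 8 / 2)) cΛ) (symTablesAn1S2 3 Lc cΛ).M ((Lc : ℝ) ^ 8) cB ((8 * (N : ℝ) ^ 2)⁻¹ • wsym22 N) (symTablesAn1S2 3 Lc cΛ).vh₂S (symTablesAn1S2 3 Lc cΛ).mixFF j κ u κ' u' +
            conjW (bhKStepSh 3 Lc (Dsh Lc) j)
              (SpureCombOf (symTablesAn1S2 3 Lc cΛ) ((Lc : ℝ) ^ 4) (-((Lc : ℝ) ^ 8 / 2)) cΛ j κ u)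
              (SpureCombOf (symTablesAn1S2 3 Lc cΛ) ((Lc : ℝ) ^ 4) (-((Lc : ℝ) ^ 8 / 2)) cΛ j κ' u')
              (diagK fun p a => γ j * ctGenM 3 (bhK Lc + Dsh Lc) α Lc κ u p a) (diagK fun p a => γ j * ctGenM 3 (bhK Lc + Dsh Lc) α Lc κ' u' p a)
              (diagK (h j α κ u κ' u')) +
            R2 j α κ u κ' u')) := by
  refine ⟨fun j => -((Lc : ℝ) ^ 8 / 2) * wVH 3 Lc j / (stepScale 3 Lc j * (Lc : ℝ) ^ 4),
    (fun (j : ℕ) (α κ : Fin 4) (u : Fin 4 → ℤ) (κ' : Fin 4) (u' : Fin 4 → ℤ) (p : Fin 4 → ℤ) (c : Fib 3) => ((fun j => -((Lc : ℝ) ^ 8 / 2) * wVH 3 Lc j / (stepScale 3 Lc j * (Lc : ℝ) ^ 4)) j * ctGenM 3 (bhK Lc + Dsh Lc) α Lc κ u p c) * ((fun j => -((Lc : ℝ) ^ 8 / 2) * wVH 3 Lc j / (stepScale 3 Lc j * (Lc : ℝ) ^ 4)) j * ctGenM 3 (bhK Lc + Dsh Lc) α Lc κ' u' p c)),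
    combR2An1 Lc N cΛ (fun j => -((Lc : ℝ) ^ 8 / 2) * wVH 3 Lc j / (stepScale 3 Lc j * (Lc : ℝ) ^ 4)) (0 : ℕ → Fin 4 → Fin 4 → (Fin 4 → ℤ) → Fin 4 → (Fin 4 → ℤ) → (Fin 4 → ℤ) → Fib 3 → ℝ),
    hhL_canon (Lc := Lc) _, hh_canon (Lc := Lc) _, hR2c_pin (Lc := Lc) N cΛ _, hR2p_pin hLc hN hΛ _ (fun _ => rfl), ?_⟩
  exact hlaw_comb_an1 hLc N cΛ hcB _ (fun _ => rfl)

end Summit.QuantumFields.BalabanUV.Beta.GAN24.CombChartQuarticLawAn1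

end
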